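import Literature.AnabelianGeometry.SemiGraphs.NotationsConventions
import Literature.AnabelianGeometry.SemiGraphs.Temperoids
import Literature.AnabelianGeometry.SemiGraphs.LocalizationsAnabelioids

/-!
# [SemiAnbd] §0 / §3 / §4 categorical vocabulary: NON-VACUITY of `AbstractEquivalence`, `ContHomCat`,
# `AnabelioidVocab` (NV-L3 wave)

S. Mochizuki, *Semi-graphs of anabelioids*, Publ. RIMS **42** (2006) 221–322, author's manuscript:
§0 p. 7 ("abstractly equivalent" functors), Prop. 3.2 p. 35 (the category of continuous homomorphisms
`Π₁ → Π₂` with conjugating elements as arrows), §2 p. 23 / §4 (the anabelioid-level vocabulary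
`Π_H := π̂₁(B(H))`) [cite: MochizukiSemiAnbd2006, §0 p.7].

abc-iut cell, layer L3, PROOF-ONLY non-vacuity file (seat abc-iut-w5-d149 gen 3; row family «NV-L3»,
abc-iut-w4-d098's INHABITATION-CENSUS-L3-v1 §A1: the three structures below have ZERO producers in the
tree).  No `def`, no `instance`, no `structure`, no named fact: every witness is built inside a theorem
term.  HONEST LABELS in each docstring (GENUINE = the printed object; PARAMETRIC = every datum of the
stated shape; DEGENERATE = trivial carriers, certifying only that the interface hides no hypothesis).

* `AbstractEquivalence` (§0 p. 7) — GENUINE: the identity square (`refl`), inversion (`symm`),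
  composition (`trans`); hence "abstractly equivalent" (`AreAbstractlyEquivalent`) is reflexive,
  symmetric and transitive, i.e. an equivalence relation on functors, as its use on p. 7 presupposes;
  and transport of a functor along equivalences of its source and target is abstractly equivalent to it.
* `ContHomCat Π₁ Π₂` (Prop. 3.2 p. 35) — GENUINE: every continuous homomorphism is an object; the
  hom-set `φ ⟶ ψ` is inhabited iff `ψ` is a `Π₂`-conjugate of `φ`; every arrow is invertible (the
  category is a groupoid); the endomorphisms of `φ` are exactly the elements of the centraliser of
  `φ(Π₁)` — the group-theoretic content the statement of Prop. 3.2 is phrased in.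
* `AnabelioidVocab Obj` (§2 p. 23 stub-container of `LocalizationsAnabelioids.lean`) — PARAMETRIC /
  DEGENERATE: the constant vocabulary at any profinite group `P` (all `Π_H := P`, all induced maps the
  identity, no pull-back components), in particular at the trivial profinite group.  The record has no
  law field, so this certifies exactly that the container constrains nothing; the GENUINE inhabitant
  (`Π_H` = the fundamental group of the connected anabelioid `B(H)`) is abc-iut-L3-t1's §2 datum and is
  NOT built here.

Nothing in this file takes a side on [IUTchIII] Cor. 3.12; a witness is consistency evidence for an
interface, not an endorsement; typed ≠ proved.
-/

namespace Literature.AnabelianGeometry.SemiGraphs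

open CategoryTheory

universe v v₁ v₂ v₃ v₄ v₅ v₆ u u₁ u₂ u₃ u₄ u₅ u₆ w

/-! ## 1. `AbstractEquivalence` (§0 p. 7) -/

section AbstractEquivalence

variable {C₁ : Type u₁} [Category.{v₁} C₁] {C₂ : Type u₂} [Category.{v₂} C₂]
  {C₃ : Type u₅} [Category.{v₅} C₃]
  {D₁ : Type u₃} [Category.{v₃} D₁] {D₂ : Type u₄} [Category.{v₄} D₂]
  {D₃ : Type u₆} [Category.{v₆} D₃]

/-- **GENUINE (identity square).** Every functor `Φ : C → D` is abstractly equivalent to itself: the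
square with both horizontal arrows the identity equivalences 1-commutes via the unitors.
[cite: MochizukiSemiAnbd2006, §0 p.7] -/
theorem AbstractEquivalence.nonempty_refl (Φ : C₁ ⥤ D₁) : Nonempty (AbstractEquivalence Φ Φ) :=
  ⟨{ top := _root_.CategoryTheory.Equivalence.refl
     bot := _root_.CategoryTheory.Equivalence.refl
     iso := Φ.leftUnitor ≪≫ Φ.rightUnitor.symm }⟩

/-- **GENUINE (inversion).** An abstract equivalence from `Φ₁` to `Φ₂` yields one from `Φ₂` to `Φ₁`
(invert both equivalences; the 1-commutativity 2-cell is transported through the unit of `bot` and the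
counit of `top`). [cite: MochizukiSemiAnbd2006, §0 p.7] -/
theorem AbstractEquivalence.nonempty_symm {Φ₁ : C₁ ⥤ D₁} {Φ₂ : C₂ ⥤ D₂}
    (E : AbstractEquivalence Φ₁ Φ₂) : Nonempty (AbstractEquivalence Φ₂ Φ₁) :=
  ⟨{ top := E.top.symm
     bot := E.bot.symm
     iso :=
      (E.top.inverse ⋙ Φ₁).rightUnitor.symm ≪≫
        Functor.isoWhiskerLeft (E.top.inverse ⋙ Φ₁) E.bot.unitIso ≪≫
        (Functor.associator (E.top.inverse ⋙ Φ₁) E.bot.functor E.bot.inverse).symm ≪≫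
        Functor.isoWhiskerRight (Functor.associator E.top.inverse Φ₁ E.bot.functor) E.bot.inverse ≪≫
        Functor.isoWhiskerRight (Functor.isoWhiskerLeft E.top.inverse E.iso.symm) E.bot.inverse ≪≫
        Functor.isoWhiskerRight (Functor.associator E.top.inverse E.top.functor Φ₂).symm E.bot.inverse ≪≫
        Functor.isoWhiskerRight (Functor.isoWhiskerRight E.top.counitIso Φ₂) E.bot.inverse ≪≫
        Functor.isoWhiskerRight Φ₂.leftUnitor E.bot.inverse }⟩

/-- **GENUINE (composition).** Abstract equivalences `Φ₁ ⇒ Φ₂` and `Φ₂ ⇒ Φ₃` compose (compose the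
horizontal equivalences; paste the two 2-cells). [cite: MochizukiSemiAnbd2006, §0 p.7] -/
theorem AbstractEquivalence.nonempty_trans {Φ₁ : C₁ ⥤ D₁} {Φ₂ : C₂ ⥤ D₂} {Φ₃ : C₃ ⥤ D₃}
    (E : AbstractEquivalence Φ₁ Φ₂) (F : AbstractEquivalence Φ₂ Φ₃) :
    Nonempty (AbstractEquivalence Φ₁ Φ₃) :=
  ⟨{ top := E.top.trans F.top
     bot := E.bot.trans F.bot
     iso :=
      Functor.associator E.top.functor F.top.functor Φ₃ ≪≫
        Functor.isoWhiskerLeft E.top.functor F.iso ≪≫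
        (Functor.associator E.top.functor Φ₂ F.bot.functor).symm ≪≫
        Functor.isoWhiskerRight E.iso F.bot.functor ≪≫
        Functor.associator Φ₁ E.bot.functor F.bot.functor }⟩

/-- "Abstractly equivalent" is REFLEXIVE. [cite: MochizukiSemiAnbd2006, §0 p.7] -/
theorem AreAbstractlyEquivalent.refl (Φ : C₁ ⥤ D₁) : AreAbstractlyEquivalent Φ Φ :=
  AbstractEquivalence.nonempty_refl Φ

/-- "Abstractly equivalent" is SYMMETRIC. [cite: MochizukiSemiAnbd2006, §0 p.7] -/
theorem AreAbstractlyEquivalent.symm {Φ₁ : C₁ ⥤ D₁} {Φ₂ : C₂ ⥤ D₂}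
    (h : AreAbstractlyEquivalent Φ₁ Φ₂) : AreAbstractlyEquivalent Φ₂ Φ₁ := by
  obtain ⟨E⟩ := h
  exact AbstractEquivalence.nonempty_symm E

/-- "Abstractly equivalent" is TRANSITIVE. [cite: MochizukiSemiAnbd2006, §0 p.7] -/
theorem AreAbstractlyEquivalent.trans {Φ₁ : C₁ ⥤ D₁} {Φ₂ : C₂ ⥤ D₂} {Φ₃ : C₃ ⥤ D₃}
    (h₁₂ : AreAbstractlyEquivalent Φ₁ Φ₂) (h₂₃ : AreAbstractlyEquivalent Φ₂ Φ₃) :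
    AreAbstractlyEquivalent Φ₁ Φ₃ := by
  obtain ⟨E⟩ := h₁₂
  obtain ⟨F⟩ := h₂₃
  exact AbstractEquivalence.nonempty_trans E F

/-- "Abstractly equivalent" is symmetric as an `Iff`. [cite: MochizukiSemiAnbd2006, §0 p.7] -/
theorem areAbstractlyEquivalent_comm {Φ₁ : C₁ ⥤ D₁} {Φ₂ : C₂ ⥤ D₂} :
    AreAbstractlyEquivalent Φ₁ Φ₂ ↔ AreAbstractlyEquivalent Φ₂ Φ₁ :=
  ⟨AreAbstractlyEquivalent.symm, AreAbstractlyEquivalent.symm⟩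

/-- **GENUINE (transport).** For equivalences `e : C₁ ≌ C₂`, `f : D₁ ≌ D₂`, the transported functor
`e⁻¹ ⋙ Φ ⋙ f : C₂ → D₂` is abstractly equivalent to `Φ : C₁ → D₁` — the typical way abstract
equivalences arise (e.g. in Thm. 6.8 (ii) "in a fashion that is functorial, up to unique isomorphisms
of equivalences of categories"). [cite: MochizukiSemiAnbd2006, §0 p.7] -/
theorem AbstractEquivalence.nonempty_transport (Φ : C₁ ⥤ D₁) (e : C₁ ≌ C₂) (f : D₁ ≌ D₂) :
    Nonempty (AbstractEquivalence Φ (e.inverse ⋙ Φ ⋙ f.functor)) :=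
  ⟨{ top := e
     bot := f
     iso :=
      (Functor.associator e.functor e.inverse (Φ ⋙ f.functor)).symm ≪≫
        Functor.isoWhiskerRight e.unitIso.symm (Φ ⋙ f.functor) ≪≫
        (Φ ⋙ f.functor).leftUnitor }⟩

/-- Hence `Φ` and its transport `e⁻¹ ⋙ Φ ⋙ f` are abstractly equivalent.
[cite: MochizukiSemiAnbd2006, §0 p.7] -/
theorem areAbstractlyEquivalent_transport (Φ : C₁ ⥤ D₁) (e : C₁ ≌ C₂) (f : D₁ ≌ D₂) :
    AreAbstractlyEquivalent Φ (e.inverse ⋙ Φ ⋙ f.functor) :=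
  AbstractEquivalence.nonempty_transport Φ e f

end AbstractEquivalence

/-! ## 2. `ContHomCat Π₁ Π₂` (Prop. 3.2 p. 35) -/

section ContHomCat

variable {G₁ : Type u} [Group G₁] [TopologicalSpace G₁] {G₂ : Type u} [Group G₂] [TopologicalSpace G₂]

/-- **GENUINE.** Every continuous homomorphism `φ : Π₁ → Π₂` is an object of the Prop. 3.2 category
(the structure is a one-field wrapper; exact inhabitation description). [cite: MochizukiSemiAnbd2006, Prop 3.2 p.35] -/
theorem ContHomCat.exists_hom_eq (φ : G₁ →ₜ* G₂) : ∃ X : ContHomCat G₁ G₂, X.hom = φ :=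
  ⟨⟨φ⟩, rfl⟩

/-- The Prop. 3.2 category is NONEMPTY for every pair of topological groups: the trivial
homomorphism is an object. [cite: MochizukiSemiAnbd2006, Prop 3.2 p.35] -/
theorem ContHomCat.nonempty : Nonempty (ContHomCat G₁ G₂) :=
  ⟨⟨1⟩⟩

/-- For `Π₁ = Π₂` the identity is an object (the object Prop. 3.2 is ultimately about: isomorphisms
`Π₁ ⥲ Π₂`). [cite: MochizukiSemiAnbd2006, Prop 3.2 p.35] -/
theorem ContHomCat.exists_hom_eq_id : ∃ X : ContHomCat G₁ G₁, X.hom = ContinuousMonoidHom.id G₁ :=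
  ⟨⟨ContinuousMonoidHom.id G₁⟩, rfl⟩

/-- **Hom-sets, exactly**: there is an arrow `φ → ψ` iff `ψ = γ_g ∘ φ` for some `g ∈ Π₂` ("morphisms
`φ → ψ` are elements `g ∈ Π₂` such that `γ_g ∘ φ = ψ`"). [cite: MochizukiSemiAnbd2006, Prop 3.2 p.35] -/
theorem ContHomCat.nonempty_hom_iff (φ ψ : ContHomCat G₁ G₂) :
    Nonempty (φ ⟶ ψ) ↔ ∃ g : G₂, ∀ x : G₁, g * φ.hom x * g⁻¹ = ψ.hom x :=
  ⟨fun ⟨f⟩ => ⟨f.elt, f.conj_eq⟩, fun ⟨g, hg⟩ => ⟨⟨g, hg⟩⟩⟩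

/-- Every object has an endomorphism (the identity, `1 ∈ Π₂`). [cite: MochizukiSemiAnbd2006, Prop 3.2 p.35] -/
theorem ContHomCat.nonempty_hom_self (φ : ContHomCat G₁ G₂) : Nonempty (φ ⟶ φ) :=
  ⟨𝟙 φ⟩

/-- **The Prop. 3.2 category is a GROUPOID**: every arrow `g : φ → ψ` is invertible, with inverse the
arrow `g⁻¹ : ψ → φ`. [cite: MochizukiSemiAnbd2006, Prop 3.2 p.35] -/
theorem ContHomCat.isIso_hom {φ ψ : ContHomCat G₁ G₂} (f : φ ⟶ ψ) : IsIso f := by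
  refine ⟨⟨⟨f.elt⁻¹, fun x => ?_⟩, ?_, ?_⟩⟩
  · rw [← f.conj_eq x]
    group
  · apply ContHomCat.Hom.ext
    change f.elt⁻¹ * f.elt = 1
    exact inv_mul_cancel f.elt
  · apply ContHomCat.Hom.ext
    change f.elt * f.elt⁻¹ = 1
    exact mul_inv_cancel f.elt

/-- Existence of an arrow is SYMMETRIC (groupoid). [cite: MochizukiSemiAnbd2006, Prop 3.2 p.35] -/
theorem ContHomCat.nonempty_hom_comm (φ ψ : ContHomCat G₁ G₂) :
    Nonempty (φ ⟶ ψ) ↔ Nonempty (ψ ⟶ φ) := by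
  constructor
  · rintro ⟨f⟩
    haveI := ContHomCat.isIso_hom f
    exact ⟨inv f⟩
  · rintro ⟨f⟩
    haveI := ContHomCat.isIso_hom f
    exact ⟨inv f⟩

/-- **Endomorphisms = centraliser of the image**: `g ∈ Π₂` is an arrow `φ → φ` iff `g` centralises
`φ(Π₁)` (so `Aut(φ) = Z_{Π₂}(φ(Π₁))`, the group whose triviality "slimness"-type hypotheses control).
[cite: MochizukiSemiAnbd2006, Prop 3.2 p.35] -/
theorem ContHomCat.exists_end_iff_mem_centralizer (φ : ContHomCat G₁ G₂) (g : G₂) :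
    (∃ f : φ ⟶ φ, f.elt = g) ↔ g ∈ Subgroup.centralizer (Set.range φ.hom) := by
  rw [Subgroup.mem_centralizer_iff]
  constructor
  · rintro ⟨f, rfl⟩ _ ⟨x, rfl⟩
    have h := f.conj_eq x
    calc φ.hom x * f.elt = f.elt * φ.hom x * f.elt⁻¹ * f.elt := by rw [h]
      _ = f.elt * φ.hom x := by rw [inv_mul_cancel_right]
  · intro h
    refine ⟨⟨g, fun x => ?_⟩, rfl⟩
    have hx := h (φ.hom x) ⟨x, rfl⟩
    rw [← hx, mul_inv_cancel_right]

end ContHomCat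

/-! ## 3. `AnabelioidVocab Obj` (§2 p. 23 stub-container) -/

section AnabelioidVocab

variable (Obj : Type u) [Category.{v} Obj]

/-- **PARAMETRIC witness (constant vocabulary).** For any profinite group `P`, the assignment
`Π_H := P` for every `H`, identity induced maps, and no pull-back components inhabits the stub
container — it has no law field, so it constrains nothing; the GENUINE datum (`Π_H = π̂₁(B(H))`) is the
§2 construction, not built here. [cite: MochizukiSemiAnbd2006, §2 p.23] -/
theorem AnabelioidVocab.nonempty_const (P : ProfiniteGrp.{w}) : Nonempty (AnabelioidVocab.{u, v, w} Obj) :=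
  ⟨{ fundGroup := fun _ => P
     fundMap := fun _ => MonoidHom.id P
     continuous_fundMap := fun _ => continuous_id
     pullbackComponents := fun _ _ => ∅ }⟩

/-- **DEGENERATE witness**: the constant vocabulary at the trivial profinite group. HONEST LABEL:
degenerate — certifies only that `AnabelioidVocab Obj` is inhabited for every category `Obj`.
[cite: MochizukiSemiAnbd2006, §2 p.23] -/
theorem AnabelioidVocab.nonempty_degenerate : Nonempty (AnabelioidVocab.{u, v, 0} Obj) :=
  AnabelioidVocab.nonempty_const Obj (ProfiniteGrp.of PUnit.{1})

end AnabelioidVocab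

end Literature.AnabelianGeometry.SemiGraphs
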